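import Summits.Ventures.DiscreteObjects.PP12.OrderElevenHomologyData

/-!
# PP(12), order-11 cell, Case A (`NoHomologyArray12`): KERNEL FUNCTIONS of the blocking certificate, part 1 — the compatibility scan (designs g22)
Framing: lottery ticket; floor = certified bounds/negative ranges.

Cell pub-namedobj (venture DiscreteObjects), target (M), P11-SIZING.md. On packed rows (`OrderElevenHomologyData`): `dg` (digit), `compat r s i i'` (the differences
`(r_j − s_j) mod 11` over the columns `j ∉ {i, i'}` are non-zero and pairwise distinct — one pass with a bitmask), `blockedAll reps cands` (no listed `s` is compatible
with any listed `r`, indices `1` / `2`), `scanOK a n` = `blockedAll` on the slice `REPS[a, a+n)` against `CANDS3`. The scan files `OrderElevenHomologyScanA/B` prove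
`scanOK (20k) 20 = true` by `decide +kernel` (≈ 60 s each: 68,820 tests; calibrated by designs g22). Soundness (normal array ⇒ `compat` of its rows `1`, `2` is `true`)
and the walkers for `CANDS2` / `CANDS3` follow in later files. No `sorry`, no axioms; nothing here asserts a census statement.
-/

set_option maxRecDepth 100000

namespace Summit.Ventures.DiscreteObjects.PP12

namespace Homology12

/-- digit `j` (base 16) of a packed row -/
def dg (r j : ℕ) : ℕ := (r >>> (4 * j)) &&& 15

/-- compatibility pass over the columns `j, j+1, …` (fuel `f`), skipping the holes `i`, `i'`; `used` = bitmask of differences seen -/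
def cgo (r s i i' : ℕ) : ℕ → ℕ → ℕ → Bool
  | 0, _, _ => true
  | f + 1, j, used =>
    if (j == i) || (j == i') then cgo r s i i' f (j + 1) used
    else
      let d := (dg r j + 11 - dg s j) % 11
      if (d == 0) || used.testBit d then false else cgo r s i i' f (j + 1) (used ||| (1 <<< d))

/-- rows `r` (index `i`) and `s` (index `i'`) are COMPATIBLE: differences over the columns `∉ {i, i'}` non-zero and pairwise distinct -/
def compat (r s i i' : ℕ) : Bool := cgo r s i i' 12 0 0

/-- every listed row of index `1` is BLOCKED by index `2`: no listed row of index `2` is compatible with it -/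
def blockedAll (reps cands : List ℕ) : Bool := reps.all fun r => cands.all fun s => !(compat r s 1 2)

/-- the scan of the slice `REPS[a, a + n)` against `CANDS3` -/
def scanOK (a n : ℕ) : Bool := blockedAll ((REPS.drop a).take n) CANDS3

end Homology12

end Summit.Ventures.DiscreteObjects.PP12
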